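import Summits.AtomisticToContinuum.Crystallization.Theorems.ChessboardParticlePlanesPeriodicWindowsShapeStationarity6

/-!
# Crux `PeriodicWindows` (stmt-AtomisticToContinuum-3240), line `Sketch` — stub E2a `stub_shapeStationarity`

The registered stub E2a of the lead skeleton `PeriodicWindowsSketch` (rev 9, route `ChessboardParticlePlanes`):
**scaling stationarity of Barlow hull sets of Lennard-Jones ground states.** Let the rotated exact Barlow stacking
`A '' barlowStacking a h s` (`a, h > 0`, `s` Hägg, `A` a linear isometry) be two-way matched at every scale by
translates of a sequence of Lennard-Jones ground states. With the site shape sums `σₙ(m) = barlowSiteEnergy Vₙ 1 (h/a) s m`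
(`Vₙ r = (r²)⁻ⁿ`): for every periodic `Q₁` and `η > 0` some layer has `(-12 e(Q₁) − η) σ₆ ≤ σ₃²`, and for every
`η > 0` some layers have `σ₆ ≤ (a⁶ + η) σ₃`, `(a⁶ − η) σ₃ ≤ σ₆`.

Proof (parts 1–6 of this series): the LJ site energy of a point of layer `m` is `2((a²)⁻⁶σ₆(m)/12 − (a²)⁻³σ₃(m)/6)`
(part 3); on the cube windows `W_K` (`(2K+1)³` points) the window bound (U) of `LayeredHull.wb_upper` and the free bound (L)
of `LayeredHull.wb_lower` for the DILATED stackings (scale `λ a`, every `λ > 0`) compare the layer averages with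
`2 E((2K+1)³)/(2K+1)³ → 2 e*` (`ChargedEnergyGapNegative.crysEnergyLimit`) up to the boundary functional, which is
`o((2K+1)³)` (part 4); the abstract stationarity lemma (part 6: Bolzano–Weierstrass on the averages, Fermat at `λ = 1`,
Jensen) gives the three site inequalities, with `e* ≤ e(Q₁)` (`ChargedEnergyGapNegative.eStar_le`).
-/

noncomputable section

namespace Summit.AtomisticToContinuum.Crystallization.Theorems.PeriodicWindowsSketch

open Filter Topology Literature.MathematicalPhysics.StatisticalMechanics
open Summit.AtomisticToContinuum.Crystallization.Theorems.ExcessDecayLiouvilleCoarseGrains (hcpSumCube)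

/-- A non-negative sequence which is eventually `≤ ε n_K` for every `ε > 0` is `o(n_K)`. [folklore] -/
theorem shp_tendsto_ratio_zero {f n : ℕ → ℝ} (hn : ∀ K, 0 < n K) (h0 : ∀ K, 0 ≤ f K)
    (h : ∀ ε : ℝ, 0 < ε → ∃ K₀ : ℕ, ∀ K : ℕ, K₀ ≤ K → f K ≤ ε * n K) :
    Tendsto (fun K => f K / n K) atTop (𝓝 0) := by
  rw [Metric.tendsto_atTop]
  intro ε hε
  obtain ⟨K₀, hK₀⟩ := h (ε / 2) (by positivity)
  refine ⟨K₀, fun K hK => ?_⟩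
  rw [Real.dist_eq, sub_zero, abs_of_nonneg (div_nonneg (h0 K) (hn K).le), div_lt_iff₀ (hn K)]
  have := hK₀ K hK
  have hn' := hn K
  nlinarith

/-- `(2K+1)³ → ∞`. [folklore] -/
theorem shp_tendsto_cube : Tendsto (fun K : ℕ => (2 * K + 1) ^ 3) atTop atTop := by
  refine tendsto_atTop_atTop.2 fun b => ⟨b, fun K hK => ?_⟩
  calc b ≤ K := hK
    _ ≤ 2 * K + 1 := by omega
    _ ≤ (2 * K + 1) ^ 3 := Nat.le_self_pow (by norm_num) _

/-- **STUB E2a `stub_shapeStationarity`** (registered signature of the lead skeleton `PeriodicWindowsSketch`, rev 9):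
scaling stationarity of a rotated exact Barlow stacking in the hull of a sequence of Lennard-Jones ground states.
[folklore] -/
theorem stub_shapeStationarity (x : (N : ℕ) → (Fin N → EuclideanSpace ℝ (Fin 3)))
    (hx : ∀ N, IsGroundState lennardJones (x N)) (a h : ℝ) (ha : 0 < a) (hh : 0 < h)
    (s : ℤ → ℤ) (hs : IsHaggSeq s) (A : EuclideanSpace ℝ (Fin 3) →ₗᵢ[ℝ] EuclideanSpace ℝ (Fin 3))
    (hH : ∀ R ε : ℝ, 0 < ε → ∃ᶠ N in Filter.atTop, ∃ t : EuclideanSpace ℝ (Fin 3),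
        (∀ p ∈ A '' barlowStacking a h s, ‖p‖ ≤ R → ∃ i : Fin N, dist (x N i + t) p ≤ ε) ∧
        (∀ i : Fin N, ‖x N i + t‖ ≤ R → ∃ p ∈ A '' barlowStacking a h s, dist (x N i + t) p ≤ ε)) :
    (∀ (Q₁ : PeriodicConfiguration 3) (η : ℝ), 0 < η → ∃ m : ℤ,
      (-(12 * Q₁.energyPerParticle lennardJones) - η) *
          barlowSiteEnergy (fun r => (r ^ 2)⁻¹ ^ 6) 1 (h / a) s m ≤
        (barlowSiteEnergy (fun r => (r ^ 2)⁻¹ ^ 3) 1 (h / a) s m) ^ 2) ∧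
    (∀ η : ℝ, 0 < η → ∃ m : ℤ,
      barlowSiteEnergy (fun r => (r ^ 2)⁻¹ ^ 6) 1 (h / a) s m ≤
        (a ^ 6 + η) * barlowSiteEnergy (fun r => (r ^ 2)⁻¹ ^ 3) 1 (h / a) s m) ∧
    (∀ η : ℝ, 0 < η → ∃ m : ℤ,
      (a ^ 6 - η) * barlowSiteEnergy (fun r => (r ^ 2)⁻¹ ^ 3) 1 (h / a) s m ≤
        barlowSiteEnergy (fun r => (r ^ 2)⁻¹ ^ 6) 1 (h / a) s m) := by
  -- the shape parameter `c = h / a`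
  obtain ⟨c, rfl⟩ : ∃ c, h = a * c := ⟨h / a, by field_simp⟩
  have hc : 0 < c := (mul_pos_iff_of_pos_left ha).1 hh
  have hca : a * c / a = c := by field_simp
  simp only [hca]
  -- uniform bounds on the site shape sums
  have hb3 : ∀ k : ℤ, 1 / 2 ≤ barlowSiteEnergy (fun r => (r ^ 2)⁻¹ ^ 3) 1 c s k ∧
      barlowSiteEnergy (fun r => (r ^ 2)⁻¹ ^ 3) 1 c s k ≤ 512 / ((min 1 c) ^ 3 * (min 1 c) ^ (2 * 3 - 3)) :=
    fun k => shp_sigma_bounds hc s (n := 3) (by norm_num) k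
  have hb6 : ∀ k : ℤ, 1 / 2 ≤ barlowSiteEnergy (fun r => (r ^ 2)⁻¹ ^ 6) 1 c s k ∧
      barlowSiteEnergy (fun r => (r ^ 2)⁻¹ ^ 6) 1 c s k ≤ 512 / ((min 1 c) ^ 3 * (min 1 c) ^ (2 * 6 - 3)) :=
    fun k => shp_sigma_bounds hc s (n := 6) (by norm_num) k
  -- the normaliser `n_K = (2K+1)³` and the energy sequence `g K = 2 E(n_K)/n_K → 2 e*`
  set nK : ℕ → ℝ := fun K => ((2 * K + 1 : ℕ) : ℝ) ^ 3 with hnK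
  have hnKpos : ∀ K, 0 < nK K := fun K => by positivity
  set estar : ℝ := ⨅ Q : PeriodicConfiguration 3, Q.energyPerParticle lennardJones with hestar
  set g : ℕ → ℝ := fun K => 2 * groundStateEnergy lennardJones 3 ((2 * K + 1) ^ 3) / nK K with hgdef
  have hg : Tendsto g atTop (𝓝 (2 * estar)) := by
    have h1 := (ChargedEnergyGapNegative.crysEnergyLimit.comp shp_tendsto_cube).const_mul 2
    refine h1.congr fun K => ?_
    simp only [Function.comp, hgdef, hnK]
    push_cast
    ring
  -- (U) at scale `a`
  have hU : ∃ (C : ℝ) (d : ℕ → ℝ), Tendsto d atTop (𝓝 0) ∧ ∀ K : ℕ,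
      2 * ((1 / 12) * ((a ^ 2)⁻¹ ^ 6 * ((∑ k ∈ Finset.Icc (-(K : ℤ)) K,
        barlowSiteEnergy (fun r => (r ^ 2)⁻¹ ^ 6) 1 c s k) / ((2 * K + 1 : ℕ) : ℝ))) -
        (1 / 6) * ((a ^ 2)⁻¹ ^ 3 * ((∑ k ∈ Finset.Icc (-(K : ℤ)) K,
          barlowSiteEnergy (fun r => (r ^ 2)⁻¹ ^ 3) 1 c s k) / ((2 * K + 1 : ℕ) : ℝ)))) ≤ g K + C * d K := by
    obtain ⟨C, hC⟩ := shp_upper_window x hx ha hc s A hH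
    set D : ℕ → ℝ := fun K => ∑ p ∈ (hcpSumCube K).image
        (fun t : ℤ × ℤ × ℤ => A (barlowPos a (a * c) s t.1 t.2.1 t.2.2)),
      (1 + Metric.infDist p (A '' barlowStacking a (a * c) s \
        ↑((hcpSumCube K).image fun t : ℤ × ℤ × ℤ => A (barlowPos a (a * c) s t.1 t.2.1 t.2.2))))⁻¹ ^ 3 with hD
    have hD0 : ∀ K, 0 ≤ D K := fun K => Finset.sum_nonneg fun p _ => by
      have := Metric.infDist_nonneg (x := p)
        (s := A '' barlowStacking a (a * c) s \
          ↑((hcpSumCube K).image fun t : ℤ × ℤ × ℤ => A (barlowPos a (a * c) s t.1 t.2.1 t.2.2)))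
      positivity
    have hsmall : ∀ ε : ℝ, 0 < ε → ∃ K₀ : ℕ, ∀ K : ℕ, K₀ ≤ K → D K ≤ ε * nK K :=
      fun ε hε => shp_boundary_small ha (mul_pos ha hc) hs A hε
    refine ⟨C, fun K => D K / nK K, shp_tendsto_ratio_zero hnKpos hD0 hsmall, fun K => ?_⟩
    have hk := hC K
    have hm : (0 : ℝ) < ((2 * K + 1 : ℕ) : ℝ) := by positivity
    calc 2 * ((1 / 12) * ((a ^ 2)⁻¹ ^ 6 * ((∑ k ∈ Finset.Icc (-(K : ℤ)) K,
            barlowSiteEnergy (fun r => (r ^ 2)⁻¹ ^ 6) 1 c s k) / ((2 * K + 1 : ℕ) : ℝ))) -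
          (1 / 6) * ((a ^ 2)⁻¹ ^ 3 * ((∑ k ∈ Finset.Icc (-(K : ℤ)) K,
            barlowSiteEnergy (fun r => (r ^ 2)⁻¹ ^ 3) 1 c s k) / ((2 * K + 1 : ℕ) : ℝ))))
        = (((2 * K + 1 : ℕ) : ℝ) ^ 2 * (2 * ((1 / 12) * ((a ^ 2)⁻¹ ^ 6 *
            ∑ k ∈ Finset.Icc (-(K : ℤ)) K, barlowSiteEnergy (fun r => (r ^ 2)⁻¹ ^ 6) 1 c s k) -
          (1 / 6) * ((a ^ 2)⁻¹ ^ 3 * ∑ k ∈ Finset.Icc (-(K : ℤ)) K,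
            barlowSiteEnergy (fun r => (r ^ 2)⁻¹ ^ 3) 1 c s k)))) / nK K := by
          simp only [hnK]; field_simp
      _ ≤ (2 * groundStateEnergy lennardJones 3 ((2 * K + 1) ^ 3) + C * D K) / nK K :=
          div_le_div_of_nonneg_right hk (hnKpos K).le
      _ = g K + C * (D K / nK K) := by simp only [hgdef]; ring
  -- (L) at every scale `l a`
  have hL : ∀ l : ℝ, 0 < l → ∃ (C : ℝ) (d : ℕ → ℝ), Tendsto d atTop (𝓝 0) ∧ ∀ K : ℕ,
      g K ≤ 2 * ((1 / 12) * (((l * a) ^ 2)⁻¹ ^ 6 * ((∑ k ∈ Finset.Icc (-(K : ℤ)) K,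
        barlowSiteEnergy (fun r => (r ^ 2)⁻¹ ^ 6) 1 c s k) / ((2 * K + 1 : ℕ) : ℝ))) -
        (1 / 6) * (((l * a) ^ 2)⁻¹ ^ 3 * ((∑ k ∈ Finset.Icc (-(K : ℤ)) K,
          barlowSiteEnergy (fun r => (r ^ 2)⁻¹ ^ 3) 1 c s k) / ((2 * K + 1 : ℕ) : ℝ)))) + C * d K := by
    intro l hl
    have hla : 0 < l * a := mul_pos hl ha
    obtain ⟨C, hC⟩ := shp_lower_window hla hc s A
    set D : ℕ → ℝ := fun K => ∑ p ∈ (hcpSumCube K).image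
        (fun t : ℤ × ℤ × ℤ => A (barlowPos (l * a) (l * a * c) s t.1 t.2.1 t.2.2)),
      (1 + Metric.infDist p (A '' barlowStacking (l * a) (l * a * c) s \
        ↑((hcpSumCube K).image fun t : ℤ × ℤ × ℤ => A (barlowPos (l * a) (l * a * c) s t.1 t.2.1 t.2.2))))⁻¹ ^ 3
      with hD
    have hD0 : ∀ K, 0 ≤ D K := fun K => Finset.sum_nonneg fun p _ => by
      have := Metric.infDist_nonneg (x := p)
        (s := A '' barlowStacking (l * a) (l * a * c) s \
          ↑((hcpSumCube K).image fun t : ℤ × ℤ × ℤ => A (barlowPos (l * a) (l * a * c) s t.1 t.2.1 t.2.2)))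
      positivity
    have hsmall : ∀ ε : ℝ, 0 < ε → ∃ K₀ : ℕ, ∀ K : ℕ, K₀ ≤ K → D K ≤ ε * nK K :=
      fun ε hε => shp_boundary_small hla (mul_pos hla hc) hs A hε
    refine ⟨C, fun K => D K / nK K, shp_tendsto_ratio_zero hnKpos hD0 hsmall, fun K => ?_⟩
    have hk := hC K
    calc g K = (2 * groundStateEnergy lennardJones 3 ((2 * K + 1) ^ 3)) / nK K := by simp only [hgdef]
      _ ≤ (((2 * K + 1 : ℕ) : ℝ) ^ 2 * (2 * ((1 / 12) * (((l * a) ^ 2)⁻¹ ^ 6 *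
            ∑ k ∈ Finset.Icc (-(K : ℤ)) K, barlowSiteEnergy (fun r => (r ^ 2)⁻¹ ^ 6) 1 c s k) -
          (1 / 6) * (((l * a) ^ 2)⁻¹ ^ 3 * ∑ k ∈ Finset.Icc (-(K : ℤ)) K,
            barlowSiteEnergy (fun r => (r ^ 2)⁻¹ ^ 3) 1 c s k))) + C * D K) / nK K :=
          div_le_div_of_nonneg_right hk (hnKpos K).le
      _ = 2 * ((1 / 12) * (((l * a) ^ 2)⁻¹ ^ 6 * ((∑ k ∈ Finset.Icc (-(K : ℤ)) K,
            barlowSiteEnergy (fun r => (r ^ 2)⁻¹ ^ 6) 1 c s k) / ((2 * K + 1 : ℕ) : ℝ))) -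
          (1 / 6) * (((l * a) ^ 2)⁻¹ ^ 3 * ((∑ k ∈ Finset.Icc (-(K : ℤ)) K,
            barlowSiteEnergy (fun r => (r ^ 2)⁻¹ ^ 3) 1 c s k) / ((2 * K + 1 : ℕ) : ℝ)))) + C * (D K / nK K) := by
          simp only [hnK]; field_simp
  -- the abstract stationarity lemma
  obtain ⟨h1, h2, h3⟩ := shp_abstract_stationarity (fun k => barlowSiteEnergy (fun r => (r ^ 2)⁻¹ ^ 3) 1 c s k)
    (fun k => barlowSiteEnergy (fun r => (r ^ 2)⁻¹ ^ 6) 1 c s k) hb3 hb6 ha estar g hg hU hL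
  refine ⟨fun Q₁ η hη => h1 _ ?_ η hη, h2, h3⟩
  exact ciInf_le ChargedEnergyGapNegative.bddBelow_energyPerParticle_lennardJones Q₁

end Summit.AtomisticToContinuum.Crystallization.Theorems.PeriodicWindowsSketch

end
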